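import Literature.Analysis.FluidPDE.FluidComputer.ThresholdLevelTableU
import HarnessLib

/-!
# Kernel run of the re-cut table over the 10⁻² box, chunks 24 … 27 (bp3 gen 13, layer 4: robustness variant U)

HONEST FRAMING: low prior, high value-of-information experiment on Tao's machine paradigm; NOT a
claim that NS blows up.

Four kernel evaluations (`decide +kernel`; no `native_decide`, no extra axioms) of the checker
`runSteps` (`ThresholdLevelCheck.lean`) with the interval gate data `GIu` (all seven data within
relative `10⁻²`) on ≤ 25 steps of `ThresholdLevelTableU.stepsU` at a time, from `Bu i` towards the next chunk's
first level, returning `Bu (i+1)` (`Bu 0 = ThresholdLevelTable.Bc0`).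
-/

namespace Literature.Analysis.FluidPDE.FluidComputer

namespace ThresholdLevelTableU

open ThresholdLevelTable (Bc0 RbIt)

set_option maxHeartbeats 10000000 in
set_option maxRecDepth 200000 in
/-- Chunk 24 of the re-cut table run over the 10⁻² box (steps 600 … 624). [folklore] -/
theorem runU24 : runSteps 60 12 3 GIu RbIt Bu24 chunkU24 4148281086901958 = some Bu25 := by
  decide +kernel

set_option maxHeartbeats 10000000 in
set_option maxRecDepth 200000 in
/-- Chunk 25 of the re-cut table run over the 10⁻² box (steps 625 … 649). [folklore] -/
theorem runU25 : runSteps 60 12 3 GIu RbIt Bu25 chunkU25 4525524321594313 = some Bu26 := by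
  decide +kernel

set_option maxHeartbeats 10000000 in
set_option maxRecDepth 200000 in
/-- Chunk 26 of the re-cut table run over the 10⁻² box (steps 650 … 674). [folklore] -/
theorem runU26 : runSteps 60 12 3 GIu RbIt Bu26 chunkU26 4937133777098678 = some Bu27 := by
  decide +kernel

set_option maxHeartbeats 10000000 in
set_option maxRecDepth 200000 in
/-- Chunk 27 of the re-cut table run over the 10⁻² box (steps 675 … 699). [folklore] -/
theorem runU27 : runSteps 60 12 3 GIu RbIt Bu27 chunkU27 5386115000203920 = some Bu28 := by
  decide +kernel

end ThresholdLevelTableU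

end Literature.Analysis.FluidPDE.FluidComputer
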